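import Summits.Ventures.PercRepro.Night2LocalRuleGood
import Summits.Ventures.PercRepro.Night2LocalRuleComp

/-!
# PercRepro — the load of the good-target rule through the faces of the sources (night-2, gen 29)

The load `dload S` of a shadow set `S` under the good-target shares `dshGT` is a sum over the points `y ∈ S` whose
erasure `Q = S ∖ y` is a lossy covering set: when `Q` has a good point, `S` receives `(Σ_w faceLossP Q w)/#gtPts Q` if
`y` is a good point of `Q` and nothing otherwise; when `Q` has no good point (the fallback to the missed-point shares)
`S` receives at most `Σ_w [y ∉ cl (Q ∖ w)] · faceLossP Q w`.

* `gtShare` — the share of the pair `(B, z)` sent to `B ∪ {z, y}`; `dshGT_eq_sum`: `dshGT B z S = Σ_{y ∈ S} [S ∖ y = B ∪ {z}] gtShare B z y`;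
* `gtShare_le`: the share is at most the loss, and vanishes unless `y` is a good point (good case) or a missed point (fallback);
* **`dload_gt_le_sum`**: the load of `S` through the faces of its sources.
-/

namespace PercRepro.Shadow

open Finset PerFlat ThmH

variable {α : Type*} [DecidableEq α] {M : Matroid α} [M.Finite]

section GTShare

variable (M) (q : ℕ) (G : Finset α)

/-- The share of the pair `(B, z)` sent to the target `B ∪ {z, y}` by the good-target rule. -/
noncomputable def gtShare (B : Finset α) (z y : α) : ℚ :=
  if (gtPts M q G (insert z B)).Nonempty then
    (if y ∈ gtPts M q G (insert z B) then loss M q G B z / ((gtPts M q G (insert z B)).card : ℚ) else 0)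
  else (if y ∈ (G \ clF M B).erase z then loss M q G B z / ((missedTargets M G B z).card : ℚ) else 0)

open scoped Classical in
/-- The coefficient of the loss in a good-target share. -/
noncomputable def gtCoef (B : Finset α) (z y : α) : ℚ :=
  if (gtPts M q G (insert z B)).Nonempty then
    (if y ∈ gtPts M q G (insert z B) then 1 / ((gtPts M q G (insert z B)).card : ℚ) else 0)
  else (if y ∈ (G \ clF M B).erase z then 1 / ((missedTargets M G B z).card : ℚ) else 0)

open scoped Classical in
/-- The load of a target `S` at the point `y` (the contribution of the source `Q = S ∖ y`): in the good case the
`P`-face losses of `Q` over the number of good points if `y` is one of them, in the fallback case the `P`-face losses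
of the faces whose closure misses `y`. -/
noncomputable def gtLoadAt (P : Finset α → Prop) [DecidablePred P] (Q : Finset α) (y : α) : ℚ :=
  if (gtPts M q G Q).Nonempty then
    (if y ∈ gtPts M q G Q then (∑ w ∈ Q, faceLossP M q G P Q w) / ((gtPts M q G Q).card : ℚ) else 0)
  else ∑ w ∈ Q, (if y ∈ G \ clF M (Q.erase w) then faceLossP M q G P Q w else 0)

end GTShare

section GTShareLemmas

variable {q : ℕ} {G : Finset α}

open scoped Classical in
/-- A good-target share of `(B, z)` at `S` is a sum over the points `y ∈ S` with `S ∖ y = B ∪ {z}`. -/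
theorem dshGT_eq_sum {B : Finset α} (hBg : B ⊆ gr M) (z : α) (S : Finset α) :
    dshGT M q G B z S = ∑ y ∈ S, if S.erase y = insert z B then gtShare M q G B z y else 0 := by
  -- a target `insert y₀ (insert z B)` has exactly one `y` with `S ∖ y = insert z B`, namely `y₀`
  have hsingle : ∀ y₀, y₀ ∉ insert z B → ∀ f : α → ℚ,
      ∑ y ∈ insert y₀ (insert z B), (if (insert y₀ (insert z B)).erase y = insert z B then f y else 0) = f y₀ := by
    intro y₀ hy₀ f
    rw [Finset.sum_eq_single y₀]
    · rw [if_pos (Finset.erase_insert hy₀)]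
    · intro y hy hne
      rw [if_neg]
      intro h
      apply hne
      have h1 : y ∈ insert y₀ (insert z B) := hy
      have h2 : y ∉ (insert y₀ (insert z B)).erase y := Finset.notMem_erase y _
      rw [h] at h2
      rw [Finset.mem_insert] at h1
      rcases h1 with h1 | h1
      · exact h1
      · exact absurd h1 h2
    · intro h; exact absurd (Finset.mem_insert_self _ _) h
  -- a set with `S ∖ y = insert z B` for some `y ∈ S` is `insert y (insert z B)` with `y ∉ insert z B`
  have hshape : ∀ y ∈ S, S.erase y = insert z B → S = insert y (insert z B) ∧ y ∉ insert z B := by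
    intro y hy h
    refine ⟨by rw [← h, Finset.insert_erase hy], ?_⟩
    rw [← h]; exact Finset.notMem_erase y S
  unfold dshGT gtShare
  by_cases hne : (gtPts M q G (insert z B)).Nonempty
  · simp only [if_pos hne]
    by_cases hS : S ∈ gtTargets M q G B z
    · obtain ⟨y₀, hy₀, rfl⟩ := mem_goodTargets.1 hS
      have hy₀B : y₀ ∉ insert z B := notMem_of_mem_goodPts hy₀
      rw [hsingle y₀ hy₀B, if_pos hy₀, card_goodTargets, if_pos hS]
    · rw [if_neg hS]
      symm
      apply Finset.sum_eq_zero
      intro y hy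
      split_ifs with h1 h2
      · exfalso
        apply hS
        obtain ⟨hSe, -⟩ := hshape y hy h1
        rw [hSe]
        exact mem_goodTargets.2 ⟨y, h2, rfl⟩
      · rfl
      · rfl
  · simp only [if_neg hne]
    unfold dshMissed
    by_cases hS : S ∈ missedTargets M G B z
    · obtain ⟨y₀, hy₀, hy₀z, rfl⟩ := mem_missedTargets.1 hS
      have hy₀B : y₀ ∉ insert z B := by
        rw [Finset.mem_insert, not_or]
        exact ⟨hy₀z, notMem_of_mem_sdiff_clF' hBg hy₀⟩
      rw [hsingle y₀ hy₀B, if_pos (Finset.mem_erase.2 ⟨hy₀z, hy₀⟩), if_pos hS]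
    · rw [if_neg hS]
      symm
      apply Finset.sum_eq_zero
      intro y hy
      split_ifs with h1 h2
      · exfalso
        apply hS
        obtain ⟨hSe, -⟩ := hshape y hy h1
        rw [hSe]
        exact mem_missedTargets.2 ⟨y, (Finset.mem_erase.1 h2).2, (Finset.mem_erase.1 h2).1, rfl⟩
      · rfl
      · rfl


/-- `gtShare = gtCoef · loss`. -/
theorem gtShare_eq_coef_mul (B : Finset α) (z y : α) :
    gtShare M q G B z y = gtCoef M q G B z y * loss M q G B z := by
  unfold gtShare gtCoef
  split_ifs <;> ring

/-- The coefficient is nonnegative and at most `1`. -/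
theorem gtCoef_nonneg (B : Finset α) (z y : α) : 0 ≤ gtCoef M q G B z y := by
  unfold gtCoef
  split_ifs <;> positivity

/-- The coefficient vanishes unless `y` is a good point (good case) or a missed point (fallback). -/
theorem gtCoef_le_one (B : Finset α) (z y : α) : gtCoef M q G B z y ≤ 1 := by
  unfold gtCoef
  have h1 : ∀ n : ℕ, (1 : ℚ) / (n : ℚ) ≤ 1 := by
    intro n
    rcases Nat.eq_zero_or_pos n with h | h
    · rw [h]; norm_num
    · rw [div_le_one (by exact_mod_cast h)]; exact_mod_cast h
  split_ifs
  · exact h1 _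
  · norm_num
  · exact h1 _
  · norm_num

open scoped Classical in
/-- **The weighted `P`-losses of the pairs whose covering set is `Q` are the weighted `P`-face losses of `Q`**
(`sum_loss_of_insert_eq` with a weight `c B z`). -/
theorem sum_loss_mul_of_insert_eq {P : Finset α → Prop} [DecidablePred P] (c : Finset α → α → ℚ) (Q : Finset α) :
    ∑ B ∈ (thinMembers M q G).filter P, ∑ z ∈ G \ clF M B,
      (if insert z B = Q then c B z * loss M q G B z else 0) =
      ∑ w ∈ Q, c (Q.erase w) w * faceLossP M q G P Q w := by
  have hstep : ∀ B ∈ (thinMembers M q G).filter P, ∑ z ∈ G \ clF M B,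
      (if insert z B = Q then c B z * loss M q G B z else 0) =
      ∑ w ∈ Q, if w ∈ G \ clF M B ∧ insert w B = Q then c B w * loss M q G B w else 0 := by
    intro B _
    rw [← Finset.sum_filter, ← Finset.sum_filter]
    apply Finset.sum_congr
    · ext w
      rw [Finset.mem_filter, Finset.mem_filter]
      constructor
      · rintro ⟨hw, h⟩
        exact ⟨by rw [← h]; exact Finset.mem_insert_self _ _, hw, h⟩
      · rintro ⟨-, hw, h⟩
        exact ⟨hw, h⟩
    · intro w _; rfl
  rw [Finset.sum_congr rfl hstep, Finset.sum_comm]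
  apply Finset.sum_congr rfl
  intro w hw
  unfold faceLossP
  split_ifs with hcond
  · rw [Finset.sum_eq_single (Q.erase w)]
    · rw [if_pos ⟨hcond.2.2, Finset.insert_erase hw⟩]
    · intro B hB hne
      rw [if_neg]
      rintro ⟨hwB, h⟩
      apply hne
      rw [← h, Finset.erase_insert]
      exact notMem_of_notMem_clF (mem_membersIn.1 (mem_thinMembers.1 (Finset.mem_filter.1 hB).1).1).1
        (Finset.mem_sdiff.1 hwB).2
    · intro h
      exact absurd (Finset.mem_filter.2 ⟨hcond.1, hcond.2.1⟩) h
  · rw [mul_zero]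
    apply Finset.sum_eq_zero
    intro B hB
    rw [if_neg]
    rintro ⟨hwB, h⟩
    apply hcond
    have hwB' : w ∉ B := notMem_of_notMem_clF
      (mem_membersIn.1 (mem_thinMembers.1 (Finset.mem_filter.1 hB).1).1).1 (Finset.mem_sdiff.1 hwB).2
    have hBQ : Q.erase w = B := by rw [← h, Finset.erase_insert hwB']
    rw [hBQ]
    exact ⟨(Finset.mem_filter.1 hB).1, (Finset.mem_filter.1 hB).2, hwB⟩

open scoped Classical in
/-- **THE LOAD OF `S` THROUGH THE FACES OF ITS SOURCES**: `dload S ≤ Σ_{y ∈ S} gtLoadAt (S ∖ y) y`. -/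
theorem dload_gt_le_sum (hG : G ∈ flatsQ M (q + 1)) (hd : (gr M \ G).card ≤ q) {P : Finset α → Prop}
    [DecidablePred P] (S : Finset α) :
    dload M q G P (dshGT M q G) S ≤ ∑ y ∈ S, gtLoadAt M q G P (S.erase y) y := by
  unfold dload
  have h1 : ∀ B ∈ (thinMembers M q G).filter P, ∑ z ∈ G \ clF M B, dshGT M q G B z S =
      ∑ y ∈ S, ∑ z ∈ G \ clF M B,
        (if insert z B = S.erase y then gtCoef M q G B z y * loss M q G B z else 0) := by
    intro B hB
    have hBg : B ⊆ gr M :=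
      (mem_Uq.1 (mem_membersIn.1 (mem_thinMembers.1 (Finset.mem_filter.1 hB).1).1).1).1
    rw [Finset.sum_comm]
    apply Finset.sum_congr rfl
    intro z _
    rw [dshGT_eq_sum hBg]
    apply Finset.sum_congr rfl
    intro y _
    split_ifs with h h' h'
    · rw [gtShare_eq_coef_mul]
    · exact absurd h.symm h'
    · exact absurd h'.symm h
    · rfl
  rw [Finset.sum_congr rfl h1, Finset.sum_comm]
  apply Finset.sum_le_sum
  intro y _
  rw [sum_loss_mul_of_insert_eq (fun B z => gtCoef M q G B z y) (S.erase y)]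
  unfold gtLoadAt
  set Q := S.erase y with hQ
  by_cases hne : (gtPts M q G Q).Nonempty
  · rw [if_pos hne]
    by_cases hy : y ∈ gtPts M q G Q
    · rw [if_pos hy, Finset.sum_div]
      apply le_of_eq
      apply Finset.sum_congr rfl
      intro w hw
      have hcoef : gtCoef M q G (Q.erase w) w y = 1 / ((gtPts M q G Q).card : ℚ) := by
        unfold gtCoef
        rw [Finset.insert_erase hw, if_pos hne, if_pos hy]
      rw [hcoef]
      ring
    · rw [if_neg hy]
      apply le_of_eq
      apply Finset.sum_eq_zero
      intro w hw
      have hcoef : gtCoef M q G (Q.erase w) w y = 0 := by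
        unfold gtCoef
        rw [Finset.insert_erase hw, if_pos hne, if_neg hy]
      rw [hcoef, zero_mul]
  · rw [if_neg hne]
    apply Finset.sum_le_sum
    intro w hw
    have hfl := faceLossP_nonneg (P := P) hG hd Q w
    by_cases hyw : y ∈ G \ clF M (Q.erase w)
    · rw [if_pos hyw]
      calc gtCoef M q G (Q.erase w) w y * faceLossP M q G P Q w
          ≤ 1 * faceLossP M q G P Q w := by
            apply mul_le_mul_of_nonneg_right (gtCoef_le_one _ _ _) hfl
        _ = faceLossP M q G P Q w := one_mul _
    · rw [if_neg hyw]
      have hcoef : gtCoef M q G (Q.erase w) w y = 0 := by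
        unfold gtCoef
        rw [Finset.insert_erase hw, if_neg hne, if_neg]
        intro h
        exact hyw (Finset.mem_erase.1 h).2
      rw [hcoef, zero_mul]

end GTShareLemmas

end PercRepro.Shadow
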